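import Literature.Probability.LatticeModels.WeightedClusterDecomposition
import HarnessLib

/-!
# Aizenman's tree diagram bound for edge-dependent couplings, I: the current-sum inequality

Topic `Literature/Probability/LatticeModels`. For couplings `K ≥ 0` on a finite simple graph `G`
(`WeightedCurrents.lean`; `Z[A] = ecurrentSum K A`, `{a,b} = {a} Δ {b}`), the intersection term of the
random-current identity for `U₄` (`Current.ursellFour_currentSum_identity`),
`P = ∑ 1{∂n₁={x,y}} 1{∂n₂={z,t}} w w 1{z ∈ C_{n₁+n₂}(x)}` (`= -U₄ Z[∅]²/2`), obeys **the tree diagram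
bound in current-sum form** (`Current.treeBound_currentSum`):

`P · Z[∅]² ≤ ∑_u Z[{x,u}] Z[{y,u}] Z[{z,u}] Z[{t,u}]`,

i.e. `|U₄(x,y,z,t)| ≤ 2 ∑_u ⟨σ_xσ_u⟩⟨σ_yσ_u⟩⟨σ_zσ_u⟩⟨σ_tσ_u⟩` after division by `Z[∅]⁴` (Aizenman 1982;
Panis 2023, §4.2, the display following Proposition 4.7). The source prints no proof for general
couplings ("it is possible to show [A] that … first moment method"); the argument formalised here is:

1. `Current.restricted_pair_bound` — a Simon-type estimate for the state off a vertex set `S`,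
   `Z_{S^c}[∅] Z[{z,t}] Z[∅] ≤ Z_{S^c}[{z,t}] Z[∅]² + Z_{S^c}[∅] ∑_{u∈S} Z[{t,u}] Z[{z,u}]`
   (i.e. `⟨σ_zσ_t⟩ - ⟨σ_zσ_t⟩_{S^c} ≤ ∑_{u∈S} ⟨σ_zσ_u⟩⟨σ_uσ_t⟩`), from the restricted switching lemma:
   if `z ↔ t` fails off `S` then the `z`-cluster of the `{z,t}`-current meets `S`, and the three-point
   identity;
2. conditioning on `S = C_{n₁+n₂}(x)` (`Current.cluster_decomposition`) turns the complementary event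
   `{z ∉ C(x)}` under `P^{xy} ⊗ P^{zt}` into `⟨σ_zσ_t⟩_{S^c}` under `P^{xy} ⊗ P^{∅}`; step 1 and the
   three-point identity `∑ 1{u ∈ C(x)} = Z[{y,u}]Z[{x,u}]` then give the bound, the `u ∈ {z,t}` terms
   absorbing the event `{z ∈ C(x)} ∪ {t ∈ C(x)}` under `P^{xy} ⊗ P^{∅}`.

## References

* M. Aizenman, Comm. Math. Phys. 86 (1982), Proposition 5.3 / §5 (tree diagram bound) [Aizenman1982].
* R. Panis, arXiv:2309.05797 (2023) = Ann. Probab. 54 (2026), §4.2 (display after Proposition 4.7)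
  [Panis2023Triviality] (held; read pp. 19–20).
* B. Simon, Comm. Math. Phys. 77 (1980) [Simon1980] (the inequality of step 1 in the nearest-neighbour case).
-/

noncomputable section

open Finset Filter
open scoped symmDiff ENNReal

namespace Literature.Probability.LatticeModels

variable {V : Type*} [Fintype V] [DecidableEq V] {G : SimpleGraph V} [DecidableRel G.Adj]

namespace Current

variable {K : G.edgeFinset → ℝ}

/-! ### Step 1: the two-point function off a vertex set -/

/-- If the `z`-cluster of a current with sources `{z} Δ {t}` avoids `S`, then `z ↔ t` through edges off
`S` (inside any larger current). [folklore] -/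
theorem add_mem_connIn_offGraph_of_cluster_disjoint {S : Finset V} {n₂ : Current G} {z t : V}
    (hs : n₂.sources = {z} ∆ {t}) (havoid : ∀ u ∈ S, u ∉ n₂.cluster z) (n₁ : Current G) :
    n₁ + n₂ ∈ connIn (offGraph G S) z t := by
  refine connIn_mono (offGraph G S) (le_add_self : n₂ ≤ n₁ + n₂) ?_
  rw [mem_connIn_iff]
  have hzt : (Percolation.openGraph n₂.traced).Reachable z t := mem_cluster_iff.1 (mem_cluster_of_sources_eq hs)
  refine reachable_tracedIn_of_forall_mem (offGraph G S) (Λ := univ.filter (· ∉ S)) (fun v hv => ?_)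
    (fun a b ha hb hab => ?_) hzt
  · exact Finset.mem_filter.2 ⟨Finset.mem_univ v, fun hvS => havoid v hvS (mem_cluster_iff.2 hv)⟩
  · exact offGraph_adj.2 ⟨hab, (Finset.mem_filter.1 ha).2, (Finset.mem_filter.1 hb).2⟩

/-- **The two-point function off a vertex set** (Simon-type inequality, current-sum form): for `K ≥ 0`,
a vertex set `S` and vertices `z, t`,
`Z_{S^c}[∅] Z[{z,t}] Z[∅] ≤ Z_{S^c}[{z,t}] Z[∅]² + Z_{S^c}[∅] ∑_{u ∈ S} Z[{t,u}] Z[{z,u}]`, i.e.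
`⟨σ_zσ_t⟩ ≤ ⟨σ_zσ_t⟩_{S^c} + ∑_{u∈S} ⟨σ_zσ_u⟩⟨σ_uσ_t⟩` for the free states of the graph and of the graph
with the edges meeting `S` removed. [cite: Simon1980, Theorem 2.1 (nearest-neighbour case)] -/
theorem restricted_pair_bound (hK : ∀ e, 0 ≤ K e) (S : Finset V) (z t : V) :
    ecurrentSumIn (offGraph G S) K ∅ * ecurrentSum K ({z} ∆ {t}) * ecurrentSum K ∅ ≤
      ecurrentSumIn (offGraph G S) K ({z} ∆ {t}) * ecurrentSum K ∅ ^ 2 +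
        ecurrentSumIn (offGraph G S) K ∅ * ∑ u ∈ S, ecurrentSum K ({t} ∆ {u}) * ecurrentSum K ({z} ∆ {u}) := by
  set G₁ := offGraph G S with hG₁
  set a : Current G × Current G → ℝ≥0∞ := fun p =>
    if IsSupp G₁ p.1 ∧ p.1.sources = ∅ then p.1.eweight K else 0 with ha
  set b : Current G → ℝ≥0∞ := fun n => if n.sources = {z} ∆ {t} then n.eweight K else 0 with hb
  -- the defect of the restricted switching is controlled by `∑_{u∈S} 1{u ∈ C_{n₂}(z)}`
  have hdef : ∑' p : Current G × Current G, a p * b p.2 * (connIn G₁ z t)ᶜ.indicator 1 (p.1 + p.2) ≤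
      ∑ u ∈ S, ecurrentSumIn G₁ K ∅ * ∑' n : Current G, b n * (if u ∈ n.cluster z then 1 else 0) := by
    calc ∑' p : Current G × Current G, a p * b p.2 * (connIn G₁ z t)ᶜ.indicator 1 (p.1 + p.2)
        ≤ ∑' p : Current G × Current G, a p * b p.2 * ∑ u ∈ S, (if u ∈ p.2.cluster z then 1 else 0) := by
          refine ENNReal.tsum_le_tsum fun p => ?_
          by_cases hs : p.2.sources = {z} ∆ {t}
          · refine mul_le_mul' le_rfl ?_
            by_cases hconn : p.1 + p.2 ∈ connIn G₁ z t
            · rw [Set.indicator_of_notMem (Set.notMem_compl_iff.2 hconn)]; exact bot_le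
            · obtain ⟨u, huS, hu⟩ : ∃ u ∈ S, u ∈ p.2.cluster z := by
                by_contra hcon
                push Not at hcon
                exact hconn (add_mem_connIn_offGraph_of_cluster_disjoint hs hcon p.1)
              rw [Set.indicator_of_mem (Set.mem_compl hconn), Pi.one_apply]
              exact le_trans (le_of_eq (if_pos hu).symm)
                (Finset.single_le_sum (f := fun u => if u ∈ p.2.cluster z then (1 : ℝ≥0∞) else 0)
                  (fun _ _ => bot_le) huS)
          · simp only [hb, if_neg hs, mul_zero, zero_mul, le_refl]
      _ = ∑ u ∈ S, ∑' p : Current G × Current G, a p * (b p.2 * (if u ∈ p.2.cluster z then 1 else 0)) := by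
          rw [← Summable.tsum_finsetSum (fun _ _ => ENNReal.summable)]
          refine tsum_congr fun p => ?_
          rw [Finset.mul_sum]
          exact Finset.sum_congr rfl fun u _ => by ring
      _ = ∑ u ∈ S, ecurrentSumIn G₁ K ∅ * ∑' n : Current G, b n * (if u ∈ n.cluster z then 1 else 0) := by
          refine Finset.sum_congr rfl fun u _ => ?_
          rw [ecurrentSumIn, tsum_mul_tsum_eq_tsum_prod]
  -- `(∑_n b n 1{u ∈ C_n(z)}) Z[∅] ≤ Z[{t,u}] Z[{z,u}]` (three-point identity, clusters grow)
  have hthree : ∀ u : V, (∑' n : Current G, b n * (if u ∈ n.cluster z then 1 else 0)) * ecurrentSum K ∅ ≤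
      ecurrentSum K ({t} ∆ {u}) * ecurrentSum K ({z} ∆ {u}) := by
    intro u
    rw [← tsum_epairWeight_mul_indicator_mem_cluster hK z t u, ecurrentSum, tsum_mul_tsum_eq_tsum_prod]
    refine ENNReal.tsum_le_tsum fun p => ?_
    rw [epairWeight_eq_mul]
    by_cases hu : u ∈ p.1.cluster z
    · rw [if_pos hu, if_pos (cluster_mono (self_le_add_right p.1 p.2) z hu)]
      exact le_of_eq (by simp only [hb]; ring)
    · simp only [if_neg hu, mul_zero, zero_mul]; exact bot_le
  -- assemble
  have hsw := ecurrentSumIn_empty_mul_ecurrentSum_pair G₁ hK z t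
  calc ecurrentSumIn G₁ K ∅ * ecurrentSum K ({z} ∆ {t}) * ecurrentSum K ∅
      = ecurrentSumIn G₁ K ({z} ∆ {t}) * ecurrentSum K ∅ ^ 2 +
          (∑' p : Current G × Current G, a p * b p.2 * (connIn G₁ z t)ᶜ.indicator 1 (p.1 + p.2)) *
            ecurrentSum K ∅ := by rw [hsw]; ring
    _ ≤ ecurrentSumIn G₁ K ({z} ∆ {t}) * ecurrentSum K ∅ ^ 2 +
          (∑ u ∈ S, ecurrentSumIn G₁ K ∅ * ∑' n : Current G, b n * (if u ∈ n.cluster z then 1 else 0)) *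
            ecurrentSum K ∅ := by gcongr
    _ = ecurrentSumIn G₁ K ({z} ∆ {t}) * ecurrentSum K ∅ ^ 2 +
          ecurrentSumIn G₁ K ∅ * ∑ u ∈ S,
            (∑' n : Current G, b n * (if u ∈ n.cluster z then 1 else 0)) * ecurrentSum K ∅ := by
        rw [Finset.sum_mul, Finset.mul_sum]
        exact congrArg _ (Finset.sum_congr rfl fun u _ => by ring)
    _ ≤ ecurrentSumIn G₁ K ({z} ∆ {t}) * ecurrentSum K ∅ ^ 2 +
          ecurrentSumIn G₁ K ∅ * ∑ u ∈ S, ecurrentSum K ({t} ∆ {u}) * ecurrentSum K ({z} ∆ {u}) :=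
        add_le_add le_rfl (mul_le_mul' le_rfl (Finset.sum_le_sum fun u _ => hthree u))

/-! ### Step 2: the tree diagram bound in current-sum form -/

omit [DecidableRel G.Adj] in
/-- `∑_u c_u 1{u ∈ C} = ∑_{u ∈ C} c_u`. [folklore] -/
theorem sum_mul_ite_mem_eq (C : Finset V) (c : V → ℝ≥0∞) :
    ∑ u, c u * (if u ∈ C then 1 else 0) = ∑ u ∈ C, c u := by
  simp only [mul_ite, mul_one, mul_zero]
  rw [Finset.sum_ite_mem, Finset.univ_inter]

/-- If the second current has sources `{z} Δ {t}` and `t ∈ C_{n₁+n₂}(x)` then `z ∈ C_{n₁+n₂}(x)`. [folklore] -/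
theorem mem_cluster_of_mem_cluster_of_sources_eq {n₁ n₂ : Current G} {x z t : V}
    (hs : n₂.sources = {z} ∆ {t}) (ht : t ∈ (n₁ + n₂).cluster x) : z ∈ (n₁ + n₂).cluster x :=
  mem_cluster_trans ht (mem_cluster_comm.1 (mem_cluster_add_of_sources_eq_right n₁ hs))

/-- **Aizenman's tree diagram bound, current-sum form** (Aizenman 1982; Panis 2023, §4.2, display
following Proposition 4.7: `|U₄(x,y,z,t)| ≤ 2∑_u ⟨σ_xσ_u⟩⟨σ_yσ_u⟩⟨σ_zσ_u⟩⟨σ_tσ_u⟩`), for couplings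
`K ≥ 0` on a finite simple graph: with `P = ∑ 1{∂n₁={x,y}} 1{∂n₂={z,t}} w w 1{z ∈ C_{n₁+n₂}(x)}`
(`= -U₄Z[∅]²/2` by `ursellFour_currentSum_identity`),
`P · Z[∅]² ≤ ∑_u Z[{x,u}] Z[{y,u}] Z[{z,u}] Z[{t,u}]`.
[cite: Panis2023Triviality, §4.2 (tree diagram bound, display after Proposition 4.7)] -/
theorem treeBound_currentSum (hK : ∀ e, 0 ≤ K e) (x y z t : V) :
    (∑' p : Current G × Current G, epairWeight K ({x} ∆ {y}) ({z} ∆ {t}) p *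
        (if z ∈ (p.1 + p.2).cluster x then 1 else 0)) * ecurrentSum K ∅ ^ 2 ≤
      ∑ u, ecurrentSum K ({x} ∆ {u}) * ecurrentSum K ({y} ∆ {u}) *
        (ecurrentSum K ({z} ∆ {u}) * ecurrentSum K ({t} ∆ {u})) := by
  -- notation
  set Z : Finset V → ℝ≥0∞ := fun A => ecurrentSum K A with hZ
  set E : Current G × Current G → ℝ≥0∞ := epairWeight K ({x} ∆ {y}) ({z} ∆ {t}) with hE
  set E0 : Current G × Current G → ℝ≥0∞ := epairWeight K ({x} ∆ {y}) ∅ with hE0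
  set C : Current G × Current G → Finset V := fun p => (p.1 + p.2).cluster x with hC
  set c : V → ℝ≥0∞ := fun u => Z ({t} ∆ {u}) * Z ({z} ∆ {u}) with hc
  set 𝒮 : Finset (Finset V) := univ.filter fun S => z ∉ S ∧ t ∉ S with h𝒮
  set P : ℝ≥0∞ := ∑' p, E p * (if z ∈ C p then 1 else 0) with hP
  set Q : ℝ≥0∞ := ∑' p, E p * (if z ∉ C p ∧ t ∉ C p then 1 else 0) with hQ
  set QS : Finset V → ℝ≥0∞ := fun S => ∑' p, E p * (if C p = S then 1 else 0) with hQS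
  set aS : Finset V → ℝ≥0∞ := fun S => ∑' p, E0 p * (if C p = S then 1 else 0) with haS
  set A0 : ℝ≥0∞ := ∑' p, E0 p * (if z ∉ C p ∧ t ∉ C p then 1 else 0) with hA0
  set A1 : ℝ≥0∞ := ∑' p, E0 p * (if z ∈ C p ∨ t ∈ C p then 1 else 0) with hA1
  set b : V → ℝ≥0∞ := fun u => ∑' p, E0 p * (if u ∈ C p then 1 else 0) with hb
  have hmem𝒮 : ∀ S, S ∈ 𝒮 ↔ z ∉ S ∧ t ∉ S := fun S => by simp [h𝒮]
  -- finiteness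
  have hZtop : ∀ A, Z A ≠ ∞ := fun A => ecurrentSum_ne_top hK A
  have hEsum : ∑' p, E p = Z ({x} ∆ {y}) * Z ({z} ∆ {t}) := tsum_epairWeight K _ _
  have hE0sum : ∑' p, E0 p = Z ({x} ∆ {y}) * Z ∅ := tsum_epairWeight K _ _
  have hQle : Q ≤ ∑' p, E p := ENNReal.tsum_le_tsum fun p =>
    calc E p * (if z ∉ C p ∧ t ∉ C p then 1 else 0) ≤ E p * 1 := mul_le_mul' le_rfl (by split_ifs <;> simp)
      _ = E p := mul_one _
  have hQtop : Q * Z ∅ ^ 2 ≠ ∞ := by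
    refine ENNReal.mul_ne_top (ne_top_of_le_ne_top ?_ hQle) (ENNReal.pow_ne_top (hZtop ∅))
    rw [hEsum]; exact ENNReal.mul_ne_top (hZtop _) (hZtop _)
  -- (s1) `Z[xy] Z[zt] = P + Q`
  have hs1 : Z ({x} ∆ {y}) * Z ({z} ∆ {t}) = P + Q := by
    rw [← hEsum, hP, hQ, ← ENNReal.tsum_add]
    refine tsum_congr fun p => ?_
    rw [← mul_add]
    by_cases hp : p.1.sources = {x} ∆ {y} ∧ p.2.sources = {z} ∆ {t}
    · by_cases hzC : z ∈ C p
      · have : ¬ (z ∉ C p ∧ t ∉ C p) := fun h => h.1 hzC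
        rw [if_pos hzC, if_neg this, add_zero, mul_one]
      · have htC : t ∉ C p := fun htC => hzC (mem_cluster_of_mem_cluster_of_sources_eq hp.2 htC)
        rw [if_neg hzC, if_pos ⟨hzC, htC⟩, zero_add, mul_one]
    · simp only [hE, epairWeight, if_neg hp, zero_mul]
  -- (s2) resolving the complementary events by the value of the cluster
  have hres : ∀ (F : Current G × Current G → ℝ≥0∞) (g : Finset V → ℝ≥0∞),
      ∑' p, F p * ((if z ∉ C p ∧ t ∉ C p then 1 else 0) * g (C p)) =
        ∑ S ∈ 𝒮, ∑' p, F p * (if C p = S then 1 else 0) * g S := by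
    intro F g
    rw [← Summable.tsum_finsetSum (fun _ _ => ENNReal.summable)]
    refine tsum_congr fun p => ?_
    have h1 : ∑ S ∈ 𝒮, F p * (if C p = S then 1 else 0) * g S =
        F p * ∑ S ∈ 𝒮, (if C p = S then g S else 0) := by
      rw [Finset.mul_sum]
      exact Finset.sum_congr rfl fun S _ => by split_ifs <;> simp
    rw [h1, Finset.sum_ite_eq]
    by_cases hCp : z ∉ C p ∧ t ∉ C p
    · rw [if_pos hCp, if_pos ((hmem𝒮 _).2 hCp), one_mul]
    · rw [if_neg hCp, if_neg (fun h => hCp ((hmem𝒮 _).1 h)), zero_mul]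
  have hQsum : Q = ∑ S ∈ 𝒮, QS S := by
    have h := hres E (fun _ => 1)
    simp only [mul_one] at h
    exact h
  have hA0sum : A0 = ∑ S ∈ 𝒮, aS S := by
    have h := hres E0 (fun _ => 1)
    simp only [mul_one] at h
    exact h
  -- (s3) the per-cluster inequality
  have hES : ∀ S ∈ 𝒮, aS S * Z ({z} ∆ {t}) * Z ∅ ≤ QS S * Z ∅ ^ 2 + aS S * ∑ u ∈ S, c u := by
    intro S hS
    obtain ⟨hzS, htS⟩ := (hmem𝒮 S).1 hS
    have hne0 : ecurrentSumIn (offGraph G S) K ∅ ≠ 0 :=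
      (lt_of_lt_of_le zero_lt_one (one_le_ecurrentSumIn_empty (offGraph G S) K)).ne'
    have hnetop : ecurrentSumIn (offGraph G S) K ∅ ≠ ∞ := ecurrentSumIn_ne_top (offGraph G S) hK ∅
    have hdec : QS S * ecurrentSumIn (offGraph G S) K ∅ = aS S * ecurrentSumIn (offGraph G S) K ({z} ∆ {t}) :=
      cluster_decomposition hK hzS htS
    have hrp := restricted_pair_bound hK S z t
    rw [← ENNReal.mul_le_mul_iff_right hne0 hnetop]
    calc ecurrentSumIn (offGraph G S) K ∅ * (aS S * Z ({z} ∆ {t}) * Z ∅)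
        = aS S * (ecurrentSumIn (offGraph G S) K ∅ * ecurrentSum K ({z} ∆ {t}) * ecurrentSum K ∅) := by
          simp only [hZ]; ring
      _ ≤ aS S * (ecurrentSumIn (offGraph G S) K ({z} ∆ {t}) * ecurrentSum K ∅ ^ 2 +
            ecurrentSumIn (offGraph G S) K ∅ * ∑ u ∈ S, ecurrentSum K ({t} ∆ {u}) * ecurrentSum K ({z} ∆ {u})) :=
          mul_le_mul' le_rfl hrp
      _ = (aS S * ecurrentSumIn (offGraph G S) K ({z} ∆ {t})) * Z ∅ ^ 2 +
            ecurrentSumIn (offGraph G S) K ∅ * (aS S * ∑ u ∈ S, c u) := by simp only [hZ, hc]; ring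
      _ = ecurrentSumIn (offGraph G S) K ∅ * (QS S * Z ∅ ^ 2 + aS S * ∑ u ∈ S, c u) := by rw [← hdec]; ring
  -- (s4) summed over the clusters
  have hs4 : A0 * Z ({z} ∆ {t}) * Z ∅ ≤ Q * Z ∅ ^ 2 + ∑ S ∈ 𝒮, aS S * ∑ u ∈ S, c u := by
    rw [hA0sum, hQsum, Finset.sum_mul, Finset.sum_mul, Finset.sum_mul, ← Finset.sum_add_distrib]
    exact Finset.sum_le_sum hES
  -- (s5) the correction terms and the events `z ∈ C(x)`, `t ∈ C(x)` under `P^{xy} ⊗ P^∅`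
  have hcorr : ∑ S ∈ 𝒮, aS S * ∑ u ∈ S, c u = ∑' p, E0 p * ((if z ∉ C p ∧ t ∉ C p then 1 else 0) * ∑ u ∈ C p, c u) := by
    rw [hres E0 (fun S => ∑ u ∈ S, c u)]
    refine Finset.sum_congr rfl fun S _ => ?_
    rw [haS, ← ENNReal.tsum_mul_right]
  have hpt : ∀ p : Current G × Current G,
      (if z ∉ C p ∧ t ∉ C p then (1 : ℝ≥0∞) else 0) * (∑ u ∈ C p, c u) +
          (if z ∈ C p ∨ t ∈ C p then 1 else 0) * (Z ({z} ∆ {t}) * Z ∅) ≤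
        ∑ u, c u * (if u ∈ C p then 1 else 0) := by
    intro p
    have hsum : ∑ u ∈ C p, c u = ∑ u, c u * (if u ∈ C p then 1 else 0) := (sum_mul_ite_mem_eq (C p) c).symm
    by_cases hCp : z ∉ C p ∧ t ∉ C p
    · have : ¬ (z ∈ C p ∨ t ∈ C p) := fun h => h.elim hCp.1 hCp.2
      rw [if_pos hCp, if_neg this, one_mul, zero_mul, add_zero, hsum]
    · have hor : z ∈ C p ∨ t ∈ C p := by
        by_contra h; exact hCp ⟨fun hz => h (Or.inl hz), fun ht => h (Or.inr ht)⟩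
      rw [if_neg hCp, if_pos hor, zero_mul, zero_add, one_mul]
      rcases hor with hzC | htC
      · calc Z ({z} ∆ {t}) * Z ∅ = c z * (if z ∈ C p then 1 else 0) := by
              rw [if_pos hzC, mul_one, hc]
              simp only [symmDiff_self, Finset.bot_eq_empty, symmDiff_comm]
          _ ≤ ∑ u, c u * (if u ∈ C p then 1 else 0) :=
              Finset.single_le_sum (f := fun u => c u * (if u ∈ C p then 1 else 0)) (fun _ _ => bot_le)
                (Finset.mem_univ z)
      · calc Z ({z} ∆ {t}) * Z ∅ = c t * (if t ∈ C p then 1 else 0) := by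
              rw [if_pos htC, mul_one, hc]
              simp only [symmDiff_self, Finset.bot_eq_empty, mul_comm]
          _ ≤ ∑ u, c u * (if u ∈ C p then 1 else 0) :=
              Finset.single_le_sum (f := fun u => c u * (if u ∈ C p then 1 else 0)) (fun _ _ => bot_le)
                (Finset.mem_univ t)
  have hs5 : ∑ S ∈ 𝒮, aS S * ∑ u ∈ S, c u + A1 * (Z ({z} ∆ {t}) * Z ∅) ≤ ∑ u, c u * b u := by
    have hb' : ∑ u, c u * b u = ∑' p, E0 p * ∑ u, c u * (if u ∈ C p then 1 else 0) := by
      simp only [hb]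
      rw [Finset.sum_congr rfl fun u _ => (ENNReal.tsum_mul_left (a := c u)).symm,
        ← Summable.tsum_finsetSum (fun _ _ => ENNReal.summable)]
      refine tsum_congr fun p => ?_
      rw [Finset.mul_sum]
      exact Finset.sum_congr rfl fun u _ => by ring
    rw [hcorr, hA1, ← ENNReal.tsum_mul_right, ← ENNReal.tsum_add, hb']
    refine ENNReal.tsum_le_tsum fun p => ?_
    rw [mul_assoc, ← mul_add]
    exact mul_le_mul' le_rfl (hpt p)
  -- (s6) `A1 + A0 = Z[xy] Z[∅]`
  have hs6 : A1 + A0 = Z ({x} ∆ {y}) * Z ∅ := by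
    rw [← hE0sum, hA1, hA0, ← ENNReal.tsum_add]
    refine tsum_congr fun p => ?_
    rw [← mul_add]
    by_cases hCp : z ∈ C p ∨ t ∈ C p
    · have : ¬ (z ∉ C p ∧ t ∉ C p) := fun h => hCp.elim h.1 h.2
      rw [if_pos hCp, if_neg this, add_zero, mul_one]
    · have : z ∉ C p ∧ t ∉ C p := ⟨fun hz => hCp (Or.inl hz), fun ht => hCp (Or.inr ht)⟩
      rw [if_neg hCp, if_pos this, zero_add, mul_one]
  -- (s7) conclusion
  have hb3 : ∀ u, b u = Z ({y} ∆ {u}) * Z ({x} ∆ {u}) := fun u =>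
    tsum_epairWeight_mul_indicator_mem_cluster hK x y u
  have key : P * Z ∅ ^ 2 + Q * Z ∅ ^ 2 ≤ ∑ u, c u * b u + Q * Z ∅ ^ 2 :=
    calc P * Z ∅ ^ 2 + Q * Z ∅ ^ 2 = (A1 + A0) * Z ({z} ∆ {t}) * Z ∅ := by
          rw [hs6, ← add_mul, ← hs1]; ring
      _ = A1 * (Z ({z} ∆ {t}) * Z ∅) + A0 * Z ({z} ∆ {t}) * Z ∅ := by ring
      _ ≤ A1 * (Z ({z} ∆ {t}) * Z ∅) + (Q * Z ∅ ^ 2 + ∑ S ∈ 𝒮, aS S * ∑ u ∈ S, c u) :=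
          add_le_add le_rfl hs4
      _ = (∑ S ∈ 𝒮, aS S * ∑ u ∈ S, c u + A1 * (Z ({z} ∆ {t}) * Z ∅)) + Q * Z ∅ ^ 2 := by ring
      _ ≤ ∑ u, c u * b u + Q * Z ∅ ^ 2 := add_le_add hs5 le_rfl
  have key' : P * Z ∅ ^ 2 ≤ ∑ u, c u * b u := (ENNReal.add_le_add_iff_right hQtop).1 key
  refine key'.trans (le_of_eq (Finset.sum_congr rfl fun u _ => ?_))
  rw [hb3, hc]
  ring

end Current

end Literature.Probability.LatticeModels

end
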